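import Mathlib
import Literature.Probability.LatticeModels.ThermodynamicLimit
import Literature.Probability.LatticeModels.SharpnessProofs
import Literature.NumberTheory.LFunctions.MoebiusDyadicModuli
import Literature.Analysis.FluidPDE.MVRelativeEnergyPointwise
import Summits.CriticalPhenomena.Ising3DConformalLimit.Theorems.PrecisionLaplacianDirectCorrelationStableTailKernelScalingAux3
import Summits.CriticalPhenomena.Ising3DConformalLimit.Theorems.PrecisionLaplacianDirectCorrelationStableTailKernelScalingAux4
import HarnessLib

/-!
# Helpers (VII) for stub `stub_kernelScaling` of line `diffusive-branch-is-nonsaturation`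
(crux `PrecisionLaplacian.DirectCorrelationStableTail`, item stmt-CriticalPhenomena-4799)

**Elementary calculus of the Gaussian–cosine test function** `φ(w) = e^{-t|w|₂²} cos(k·w)` on
`ℝ³ = Fin 3 → ℝ` (`t > 0`), without derivatives (registered helper sub-goal
`stub_kernelScaling_auxSecondDiff`).  With `S = |w|₂²`, `θ = k·w`, `β = 2t w·u`, `τ = t|u|₂²`,
`κ = k·u`, the symmetric second difference has the closed form
`2φ(w) − φ(w+u) − φ(w−u) = e^{-tS}(cos θ · a − sin θ · b)` (`kernSc_secondDiff_eq`), and the scalar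
bounds of file (III), the bookkeeping of file (IV) and the absorption
`(1+M+S)³e^{4tM}e^{-(t/2)S} ≤ C` (`M = Σ|wᵢ|`, `M² ≤ 3S`; reusing `MoebiusDyadic.mul_exp_neg_le_inv` and
`CompressibleEuler.sq_sum_abs_le_three` from the Literature library) give
* the Gaussian **envelope** `|2φ(w) − φ(w+u) − φ(w−u)| ≤ A |u|₂² e^{-(t/2)|w|₂²}` (`|u|₂ ≤ 1`);
* the **Lipschitz bound** `|φ(w') − φ(w)| ≤ L ρ` and the **equi-Lipschitz bound**
  `|Δ²_u φ(w') − Δ²_u φ(w)| ≤ L ρ |u|₂²` for `‖w' − w‖ ≤ ρ ≤ 1`, `|u|₂ ≤ 1`.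
`φ` enters only through the hypothesis `∀ v, φ v = exp(-(t Σ vᵢ²)) cos(Σ kᵢ vᵢ)`.  All folklore; no
definitions are introduced.
-/

noncomputable section

namespace Summit.CriticalPhenomena.Ising3DConformalLimit.Cruxes.DirectCorrelationStableTail.DiffusiveBranchIsNonsaturation

open Filter Topology
open scoped BigOperators
open Literature.Probability.LatticeModels

/-! ### Absorbing polynomial and exponential growth into the Gaussian -/

/-- For `t > 0` there is `C` with `(1 + M + S)³ e^{4tM} e^{-(t/2)S} ≤ C` whenever `S, M ≥ 0` and
`M² ≤ 3S` (as for `S = |w|₂²`, `M = Σ|wᵢ|`). [folklore] -/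
theorem kernSc_absorb {t : ℝ} (ht : 0 < t) :
    ∃ C : ℝ, 0 < C ∧ ∀ S M : ℝ, 0 ≤ S → 0 ≤ M → M ^ 2 ≤ 3 * S →
      (1 + M + S) ^ 3 * Real.exp (4 * t * M) * Real.exp (-(t / 2 * S)) ≤ C := by
  refine ⟨8 * Real.exp (48 * t) * (1 + 12 / t) ^ 3, by positivity, fun S M hS hM hMS => ?_⟩
  have h1 : 4 * t * M ≤ t / 4 * S + 48 * t := by
    nlinarith [mul_nonneg ht.le (sq_nonneg (M - 24))]
  have h2 : M ≤ 1 + S := by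
    have h : M ^ 2 ≤ (1 + S) ^ 2 := by nlinarith [sq_nonneg (S - 1)]
    exact (pow_le_pow_iff_left₀ hM (by positivity) two_ne_zero).1 h
  have h3 : (1 + M + S) ^ 3 ≤ 8 * (1 + S) ^ 3 := by
    have h : 1 + M + S ≤ 2 * (1 + S) := by linarith
    calc (1 + M + S) ^ 3 ≤ (2 * (1 + S)) ^ 3 := pow_le_pow_left₀ (by positivity) h 3
      _ = 8 * (1 + S) ^ 3 := by ring
  have h4 : Real.exp (4 * t * M) * Real.exp (-(t / 2 * S)) ≤
      Real.exp (48 * t) * Real.exp (-(t / 4 * S)) := by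
    rw [← Real.exp_add, ← Real.exp_add]
    exact Real.exp_le_exp.2 (by linarith)
  have h5 : (1 + S) * Real.exp (-(t / 12 * S)) ≤ 1 + 12 / t := by
    have h := Literature.NumberTheory.LFunctions.MoebiusDyadic.mul_exp_neg_le_inv (a := t / 12) (by positivity) S
    have he : Real.exp (-(t / 12 * S)) ≤ 1 := Real.exp_le_one_iff.2 (by nlinarith)
    rw [one_div_div] at h
    linarith
  have h6 : (1 + S) ^ 3 * Real.exp (-(t / 4 * S)) ≤ (1 + 12 / t) ^ 3 := by
    have h : Real.exp (-(t / 4 * S)) = Real.exp (-(t / 12 * S)) ^ 3 := by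
      rw [← Real.exp_nat_mul]
      congr 1
      push_cast
      ring
    rw [h, ← mul_pow]
    exact pow_le_pow_left₀ (by positivity) h5 3
  calc (1 + M + S) ^ 3 * Real.exp (4 * t * M) * Real.exp (-(t / 2 * S))
      = (1 + M + S) ^ 3 * (Real.exp (4 * t * M) * Real.exp (-(t / 2 * S))) := by ring
    _ ≤ (8 * (1 + S) ^ 3) * (Real.exp (48 * t) * Real.exp (-(t / 4 * S))) :=
        mul_le_mul h3 h4 (by positivity) (by positivity)
    _ = 8 * Real.exp (48 * t) * ((1 + S) ^ 3 * Real.exp (-(t / 4 * S))) := by ring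
    _ ≤ 8 * Real.exp (48 * t) * (1 + 12 / t) ^ 3 :=
        mul_le_mul_of_nonneg_left h6 (by positivity)

/-! ### The closed form of the symmetric second difference -/

/-- Closed form: `2φ(w) − φ(w+u) − φ(w−u) = e^{-t|w|₂²}(cos θ · a − sin θ · b)` with
`θ = k·w`, `β = 2t w·u`, `τ = t|u|₂²`, `κ = k·u`. [folklore] -/
theorem kernSc_secondDiff_eq {t : ℝ} {k : Fin 3 → ℝ} {φ : (Fin 3 → ℝ) → ℝ}
    (hφ : ∀ v, φ v = Real.exp (-(t * ∑ i, v i ^ 2)) * Real.cos (∑ i, k i * v i))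
    (w u : Fin 3 → ℝ) :
    2 * φ w - φ (w + u) - φ (w - u) =
      Real.exp (-(t * ∑ i, w i ^ 2)) *
        (Real.cos (∑ i, k i * w i) *
            (2 - Real.exp (-(t * ∑ i, u i ^ 2)) * Real.cos (∑ i, k i * u i) *
              (Real.exp (2 * t * ∑ i, w i * u i) + Real.exp (-(2 * t * ∑ i, w i * u i)))) -
          Real.sin (∑ i, k i * w i) *
            (Real.exp (-(t * ∑ i, u i ^ 2)) * Real.sin (∑ i, k i * u i) *
              (Real.exp (2 * t * ∑ i, w i * u i) - Real.exp (-(2 * t * ∑ i, w i * u i))))) := by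
  have hS1 : ∑ i, (w + u) i ^ 2 = ∑ i, w i ^ 2 + 2 * ∑ i, w i * u i + ∑ i, u i ^ 2 := by
    simp only [Pi.add_apply, add_sq, Finset.sum_add_distrib, Finset.mul_sum, mul_assoc]
  have hS2 : ∑ i, (w - u) i ^ 2 = ∑ i, w i ^ 2 - 2 * ∑ i, w i * u i + ∑ i, u i ^ 2 := by
    simp only [Pi.sub_apply, sub_sq, Finset.sum_add_distrib, Finset.sum_sub_distrib, Finset.mul_sum,
      mul_assoc]
  have hθ1 : ∑ i, k i * (w + u) i = ∑ i, k i * w i + ∑ i, k i * u i := by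
    simp only [Pi.add_apply, mul_add, Finset.sum_add_distrib]
  have hθ2 : ∑ i, k i * (w - u) i = ∑ i, k i * w i - ∑ i, k i * u i := by
    simp only [Pi.sub_apply, mul_sub, Finset.sum_sub_distrib]
  have e1 : Real.exp (-(t * ∑ i, (w + u) i ^ 2)) = Real.exp (-(t * ∑ i, w i ^ 2)) *
      Real.exp (-(2 * t * ∑ i, w i * u i)) * Real.exp (-(t * ∑ i, u i ^ 2)) := by
    rw [hS1, ← Real.exp_add, ← Real.exp_add]
    congr 1
    ring
  have e2 : Real.exp (-(t * ∑ i, (w - u) i ^ 2)) = Real.exp (-(t * ∑ i, w i ^ 2)) *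
      Real.exp (2 * t * ∑ i, w i * u i) * Real.exp (-(t * ∑ i, u i ^ 2)) := by
    rw [hS2, ← Real.exp_add, ← Real.exp_add]
    congr 1
    ring
  have c1 : Real.cos (∑ i, k i * (w + u) i) =
      Real.cos (∑ i, k i * w i) * Real.cos (∑ i, k i * u i) -
        Real.sin (∑ i, k i * w i) * Real.sin (∑ i, k i * u i) := by
    rw [hθ1, Real.cos_add]
  have c2 : Real.cos (∑ i, k i * (w - u) i) =
      Real.cos (∑ i, k i * w i) * Real.cos (∑ i, k i * u i) +
        Real.sin (∑ i, k i * w i) * Real.sin (∑ i, k i * u i) := by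
    rw [hθ2, Real.cos_sub]
  rw [hφ w, hφ (w + u), hφ (w - u), e1, e2, c1, c2]
  ring

/-! ### The Gaussian envelope of the second difference -/

/-- **Envelope.**  For `t > 0` there is `A` with
`|2φ(w) − φ(w+u) − φ(w−u)| ≤ A |u|₂² e^{-(t/2)|w|₂²}` for all `w` and all `|u|₂ ≤ 1`. [folklore] -/
theorem kernSc_secondDiff_env {t : ℝ} (ht : 0 < t) (k : Fin 3 → ℝ) :
    ∃ A : ℝ, 0 < A ∧ ∀ (φ : (Fin 3 → ℝ) → ℝ),
      (∀ v, φ v = Real.exp (-(t * ∑ i, v i ^ 2)) * Real.cos (∑ i, k i * v i)) →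
      ∀ w u : Fin 3 → ℝ, ∑ i, u i ^ 2 ≤ 1 →
        |2 * φ w - φ (w + u) - φ (w - u)| ≤
          A * (∑ i, u i ^ 2) * Real.exp (-(t / 2 * ∑ i, w i ^ 2)) := by
  obtain ⟨C, hC, hCb⟩ := kernSc_absorb ht
  set K : ℝ := ∑ i, k i ^ 2 with hK
  have hK0 : 0 ≤ K := Finset.sum_nonneg fun i _ => sq_nonneg _
  refine ⟨2 * (4 * t ^ 2 + t + K) * C, by positivity, fun φ hφ w u hu => ?_⟩
  rw [kernSc_secondDiff_eq hφ w u]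
  set S : ℝ := ∑ i, w i ^ 2 with hS
  set M : ℝ := ∑ i, |w i| with hM
  set Su : ℝ := ∑ i, u i ^ 2 with hSu
  set B : ℝ := ∑ i, w i * u i with hB
  set κ : ℝ := ∑ i, k i * u i with hκ
  set θ : ℝ := ∑ i, k i * w i with hθ
  set β : ℝ := 2 * t * B with hβ
  set τ : ℝ := t * Su with hτ
  have hS0 : 0 ≤ S := Finset.sum_nonneg fun i _ => sq_nonneg _
  have hM0 : 0 ≤ M := Finset.sum_nonneg fun i _ => abs_nonneg _
  have hSu0 : 0 ≤ Su := Finset.sum_nonneg fun i _ => sq_nonneg _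
  have hMS : M ^ 2 ≤ 3 * S := Literature.Analysis.FluidPDE.CompressibleEuler.sq_sum_abs_le_three w
  have hτ0 : 0 ≤ τ := by positivity
  have hui : ∀ i, |u i| ≤ 1 := kernSc_abs_le_one_of_sum_sq_le hu
  have hβM : |β| ≤ 2 * t * M := by
    rw [hβ, abs_mul, abs_of_pos (by positivity : (0 : ℝ) < 2 * t)]
    exact mul_le_mul_of_nonneg_left (kernSc_abs_inner_le_sum_abs w u hui) (by positivity)
  have hβ2 : β ^ 2 ≤ 4 * t ^ 2 * S * Su := by
    have h := kernSc_inner_sq_le w u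
    rw [hβ, mul_pow, mul_pow]
    nlinarith [sq_nonneg t]
  have hκ2 : κ ^ 2 ≤ K * Su := kernSc_inner_sq_le k u
  have hab := kernSc_ab_bound (τ := τ) (κ := κ) (β := β) hτ0
  set a : ℝ := 2 - Real.exp (-τ) * Real.cos κ * (Real.exp β + Real.exp (-β)) with ha
  set b : ℝ := Real.exp (-τ) * Real.sin κ * (Real.exp β - Real.exp (-β)) with hb
  set E : ℝ := Real.exp (-(t * S)) with hE
  have hE0 : 0 < E := Real.exp_pos _
  have h1 : |E * (Real.cos θ * a - Real.sin θ * b)| ≤ E * (|a| + |b|) := by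
    rw [abs_mul, abs_of_pos hE0]
    refine mul_le_mul_of_nonneg_left ((abs_sub _ _).trans (add_le_add ?_ ?_)) hE0.le
    · rw [abs_mul]
      exact (mul_le_mul_of_nonneg_right (Real.abs_cos_le_one _) (abs_nonneg _)).trans (by simp)
    · rw [abs_mul]
      exact (mul_le_mul_of_nonneg_right (Real.abs_sin_le_one _) (abs_nonneg _)).trans (by simp)
  have h2 : Real.exp (2 * |β|) ≤ Real.exp (4 * t * M) := Real.exp_le_exp.2 (by linarith)
  have hP1 : 1 ≤ 1 + M + S := by linarith
  have hP3 : 1 + M + S ≤ (1 + M + S) ^ 3 := le_self_pow₀ hP1 (by norm_num)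
  have h3 : β ^ 2 + τ + κ ^ 2 ≤ (4 * t ^ 2 + t + K) * (1 + M + S) ^ 3 * Su := by
    have h31 : β ^ 2 + τ + κ ^ 2 ≤ (4 * t ^ 2 * S + t + K) * Su := by
      rw [hτ]
      nlinarith
    have h32 : 4 * t ^ 2 * S + t + K ≤ (4 * t ^ 2 + t + K) * (1 + M + S) ^ 3 := by
      have h4 : S ≤ (1 + M + S) ^ 3 := by linarith
      have h5 : 1 ≤ (1 + M + S) ^ 3 := by linarith
      nlinarith [mul_le_mul_of_nonneg_left h4 (by positivity : (0 : ℝ) ≤ 4 * t ^ 2),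
        mul_le_mul_of_nonneg_left h5 (by positivity : (0 : ℝ) ≤ t + K)]
    exact h31.trans (mul_le_mul_of_nonneg_right h32 hSu0)
  have h4 : E = Real.exp (-(t / 2 * S)) * Real.exp (-(t / 2 * S)) := by
    rw [hE, ← Real.exp_add]
    congr 1
    ring
  calc |E * (Real.cos θ * a - Real.sin θ * b)| ≤ E * (|a| + |b|) := h1
    _ ≤ E * (2 * Real.exp (2 * |β|) * (β ^ 2 + τ + κ ^ 2)) := mul_le_mul_of_nonneg_left hab hE0.le
    _ ≤ E * (2 * Real.exp (4 * t * M) * ((4 * t ^ 2 + t + K) * (1 + M + S) ^ 3 * Su)) := by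
        gcongr
    _ = 2 * (4 * t ^ 2 + t + K) *
          ((1 + M + S) ^ 3 * Real.exp (4 * t * M) * Real.exp (-(t / 2 * S))) *
            Su * Real.exp (-(t / 2 * S)) := by
        rw [h4]
        ring
    _ ≤ 2 * (4 * t ^ 2 + t + K) * C * Su * Real.exp (-(t / 2 * S)) := by
        gcongr
        exact hCb S M hS0 hM0 hMS
    _ = 2 * (4 * t ^ 2 + t + K) * C * Su * Real.exp (-(t / 2 * S)) := rfl

/-! ### The Lipschitz bounds -/

/-- Variation of the Gaussian factor under a `ρ`-perturbation (`ρ ≤ 1`), with envelope: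
`|e^{-t S'} − e^{-t S}| ≤ 3t e^{3t} ρ (1 + M + S) e^{-(t/2) S}`. [folklore] -/
theorem kernSc_gauss_diff_le {t : ℝ} (ht : 0 < t) {ρ : ℝ} (hρ0 : 0 ≤ ρ) (hρ1 : ρ ≤ 1)
    (w w' : Fin 3 → ℝ) (hci : ∀ i, |w' i - w i| ≤ ρ) :
    |Real.exp (-(t * ∑ i, w' i ^ 2)) - Real.exp (-(t * ∑ i, w i ^ 2))| ≤
      3 * t * Real.exp (3 * t) * ρ *
        ((1 + ∑ i, |w i| + ∑ i, w i ^ 2) * Real.exp (-(t / 2 * ∑ i, w i ^ 2))) := by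
  set S : ℝ := ∑ i, w i ^ 2 with hS
  set S' : ℝ := ∑ i, w' i ^ 2 with hS'
  set M : ℝ := ∑ i, |w i| with hM
  have hS0 : 0 ≤ S := Finset.sum_nonneg fun i _ => sq_nonneg _
  have hM0 : 0 ≤ M := Finset.sum_nonneg fun i _ => abs_nonneg _
  have hdS : |S' - S| ≤ ρ * (2 * M + 3 * ρ) := kernSc_sum_sq_sub_le w w' hρ0 hci
  have hS'S : S ≤ 2 * S' + 6 * ρ ^ 2 := kernSc_sum_sq_le_two_mul_of_close w w' hci
  have h1 := kernSc_abs_exp_sub_exp_le (-(t * S')) (-(t * S))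
  have h2 : |-(t * S') - -(t * S)| ≤ t * (ρ * (2 * M + 3 * ρ)) := by
    rw [show -(t * S') - -(t * S) = -(t * (S' - S)) by ring, abs_neg, abs_mul, abs_of_pos ht]
    exact mul_le_mul_of_nonneg_left hdS ht.le
  have h3 : Real.exp (max (-(t * S')) (-(t * S))) ≤ Real.exp (3 * t) * Real.exp (-(t / 2 * S)) := by
    rw [← Real.exp_add]
    have hρ2 : ρ ^ 2 ≤ 1 := by nlinarith
    have hh : t * S ≤ t * (2 * S' + 6 * ρ ^ 2) := mul_le_mul_of_nonneg_left hS'S ht.le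
    have hh2 : t * ρ ^ 2 ≤ t := by nlinarith
    have hh3 : 0 ≤ t * S := by positivity
    refine Real.exp_le_exp.2 (max_le ?_ ?_) <;> nlinarith
  calc |Real.exp (-(t * S')) - Real.exp (-(t * S))|
      ≤ |-(t * S') - -(t * S)| * Real.exp (max (-(t * S')) (-(t * S))) := h1
    _ ≤ (t * (ρ * (2 * M + 3 * ρ))) * (Real.exp (3 * t) * Real.exp (-(t / 2 * S))) :=
        mul_le_mul h2 h3 (by positivity) (by positivity)
    _ ≤ (t * (ρ * (3 * (1 + M + S)))) * (Real.exp (3 * t) * Real.exp (-(t / 2 * S))) := by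
        gcongr
        nlinarith
    _ = 3 * t * Real.exp (3 * t) * ρ * ((1 + M + S) * Real.exp (-(t / 2 * S))) := by ring

/-- **Lipschitz bound for `φ`.**  For `t > 0` there is `L` with `|φ(w') − φ(w)| ≤ L ρ` whenever
`‖w' − w‖ ≤ ρ ≤ 1`. [folklore] -/
theorem kernSc_phi_lipschitz {t : ℝ} (ht : 0 < t) (k : Fin 3 → ℝ) :
    ∃ L : ℝ, 0 < L ∧ ∀ (φ : (Fin 3 → ℝ) → ℝ),
      (∀ v, φ v = Real.exp (-(t * ∑ i, v i ^ 2)) * Real.cos (∑ i, k i * v i)) →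
      ∀ ρ : ℝ, 0 ≤ ρ → ρ ≤ 1 → ∀ w w' : Fin 3 → ℝ, ‖w' - w‖ ≤ ρ → |φ w' - φ w| ≤ L * ρ := by
  obtain ⟨C, hC, hCb⟩ := kernSc_absorb ht
  set K₁ : ℝ := ∑ i, |k i| with hK₁
  have hK₁0 : 0 ≤ K₁ := Finset.sum_nonneg fun i _ => abs_nonneg _
  refine ⟨3 * t * Real.exp (3 * t) * C + K₁, by positivity, fun φ hφ ρ hρ0 hρ1 w w' hww => ?_⟩
  have hci : ∀ i, |w' i - w i| ≤ ρ := kernSc_coord_abs_le_of_norm_le hww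
  set S : ℝ := ∑ i, w i ^ 2 with hS
  set S' : ℝ := ∑ i, w' i ^ 2 with hS'
  set M : ℝ := ∑ i, |w i| with hM
  set θ : ℝ := ∑ i, k i * w i with hθ
  set θ' : ℝ := ∑ i, k i * w' i with hθ'
  have hS0 : 0 ≤ S := Finset.sum_nonneg fun i _ => sq_nonneg _
  have hM0 : 0 ≤ M := Finset.sum_nonneg fun i _ => abs_nonneg _
  have hMS : M ^ 2 ≤ 3 * S := Literature.Analysis.FluidPDE.CompressibleEuler.sq_sum_abs_le_three w
  have hdS : |S' - S| ≤ ρ * (2 * M + 3 * ρ) := kernSc_sum_sq_sub_le w w' hρ0 hci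
  have hS'S : S ≤ 2 * S' + 6 * ρ ^ 2 := kernSc_sum_sq_le_two_mul_of_close w w' hci
  have hdθ : |θ' - θ| ≤ K₁ * ρ := kernSc_abs_inner_sub_le k w w' hci
  -- the exponential factor
  have hE : |Real.exp (-(t * S')) - Real.exp (-(t * S))| ≤
      3 * t * Real.exp (3 * t) * ρ * ((1 + M + S) * Real.exp (-(t / 2 * S))) :=
    kernSc_gauss_diff_le ht hρ0 hρ1 w w' hci
  have hG : (1 + M + S) * Real.exp (-(t / 2 * S)) ≤ C := by
    have h1 : (1 + M + S) ≤ (1 + M + S) ^ 3 := le_self_pow₀ (by linarith) (by norm_num)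
    have h2 : (1 : ℝ) ≤ Real.exp (4 * t * M) := Real.one_le_exp (by positivity)
    calc (1 + M + S) * Real.exp (-(t / 2 * S))
        ≤ (1 + M + S) ^ 3 * Real.exp (4 * t * M) * Real.exp (-(t / 2 * S)) := by
          rw [mul_assoc]
          refine mul_le_mul h1 ?_ (by positivity) (by positivity)
          nlinarith [Real.exp_pos (-(t / 2 * S))]
      _ ≤ C := hCb S M hS0 hM0 hMS
  rw [hφ w', hφ w]
  have hsplit : Real.exp (-(t * S')) * Real.cos θ' - Real.exp (-(t * S)) * Real.cos θ =
      (Real.exp (-(t * S')) - Real.exp (-(t * S))) * Real.cos θ' +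
        Real.exp (-(t * S)) * (Real.cos θ' - Real.cos θ) := by ring
  rw [hsplit]
  have he1 : Real.exp (-(t * S)) ≤ 1 := Real.exp_le_one_iff.2 (by nlinarith)
  calc _ ≤ |(Real.exp (-(t * S')) - Real.exp (-(t * S))) * Real.cos θ'| +
        |Real.exp (-(t * S)) * (Real.cos θ' - Real.cos θ)| := abs_add_le _ _
    _ ≤ 3 * t * Real.exp (3 * t) * ρ * C + K₁ * ρ := by
        rw [abs_mul, abs_mul, abs_of_pos (Real.exp_pos _)]
        refine add_le_add ?_ ?_
        · calc |Real.exp (-(t * S')) - Real.exp (-(t * S))| * |Real.cos θ'|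
              ≤ (3 * t * Real.exp (3 * t) * ρ * ((1 + M + S) * Real.exp (-(t / 2 * S)))) * 1 :=
                mul_le_mul hE (Real.abs_cos_le_one _) (abs_nonneg _) (by positivity)
            _ ≤ 3 * t * Real.exp (3 * t) * ρ * C := by
                rw [mul_one]
                exact mul_le_mul_of_nonneg_left hG (by positivity)
        · calc Real.exp (-(t * S)) * |Real.cos θ' - Real.cos θ| ≤ 1 * (K₁ * ρ) :=
                mul_le_mul he1 ((Real.abs_cos_sub_cos_le _ _).trans hdθ) (abs_nonneg _) zero_le_one
            _ = K₁ * ρ := one_mul _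
    _ = (3 * t * Real.exp (3 * t) * C + K₁) * ρ := by ring

/-- **Equi-Lipschitz bound for the second differences.**  For `t > 0` there is `L` with
`|Δ²_u φ(w') − Δ²_u φ(w)| ≤ L ρ |u|₂²` whenever `|u|₂ ≤ 1` and `‖w' − w‖ ≤ ρ ≤ 1`, where
`Δ²_u φ(w) = 2φ(w) − φ(w+u) − φ(w−u)`. [folklore] -/
theorem kernSc_secondDiff_lipschitz {t : ℝ} (ht : 0 < t) (k : Fin 3 → ℝ) :
    ∃ L : ℝ, 0 < L ∧ ∀ (φ : (Fin 3 → ℝ) → ℝ),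
      (∀ v, φ v = Real.exp (-(t * ∑ i, v i ^ 2)) * Real.cos (∑ i, k i * v i)) →
      ∀ ρ : ℝ, 0 ≤ ρ → ρ ≤ 1 → ∀ w w' u : Fin 3 → ℝ, ∑ i, u i ^ 2 ≤ 1 → ‖w' - w‖ ≤ ρ →
        |(2 * φ w' - φ (w' + u) - φ (w' - u)) - (2 * φ w - φ (w + u) - φ (w - u))| ≤
          L * ρ * ∑ i, u i ^ 2 := by
  obtain ⟨C, hC, hCb⟩ := kernSc_absorb ht
  have hK0 : 0 ≤ ∑ i, k i ^ 2 := Finset.sum_nonneg fun i _ => sq_nonneg _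
  have hK₁0 : 0 ≤ ∑ i, |k i| := Finset.sum_nonneg fun i _ => abs_nonneg _
  refine ⟨(6 * t * (12 * t ^ 2 + t + ∑ i, k i ^ 2) * Real.exp (15 * t) +
      2 * (∑ i, |k i|) * (12 * t ^ 2 + t + ∑ i, k i ^ 2) * Real.exp (12 * t) +
      Real.exp (36 * t) * (180 * t ^ 2 + 36 * t * ∑ i, |k i|)) * C, by positivity,
    fun φ hφ ρ hρ0 hρ1 w w' u hu hww => ?_⟩
  have hci : ∀ i, |w' i - w i| ≤ ρ := kernSc_coord_abs_le_of_norm_le hww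
  have hui : ∀ i, |u i| ≤ 1 := kernSc_abs_le_one_of_sum_sq_le hu
  have hS0 : 0 ≤ ∑ i, w i ^ 2 := Finset.sum_nonneg fun i _ => sq_nonneg _
  have hM0 : 0 ≤ ∑ i, |w i| := Finset.sum_nonneg fun i _ => abs_nonneg _
  have hSu0 : 0 ≤ ∑ i, u i ^ 2 := Finset.sum_nonneg fun i _ => sq_nonneg _
  have hU0 : 0 ≤ ∑ i, |u i| := Finset.sum_nonneg fun i _ => abs_nonneg _
  have hτ0 : 0 ≤ t * ∑ i, u i ^ 2 := by positivity
  have hU3 : ∑ i, |u i| ≤ 3 := by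
    calc ∑ i, |u i| ≤ ∑ _i : Fin 3, (1 : ℝ) := Finset.sum_le_sum fun i _ => hui i
      _ = 3 := by simp
  have hGpow : ∀ j : ℕ, j ≤ 3 → (1 + ∑ i, |w i| + ∑ i, w i ^ 2) ^ j *
      Real.exp (4 * t * ∑ i, |w i|) * Real.exp (-(t / 2 * ∑ i, w i ^ 2)) ≤ C := by
    intro j hj
    have h1 : (1 + ∑ i, |w i| + ∑ i, w i ^ 2) ^ j ≤ (1 + ∑ i, |w i| + ∑ i, w i ^ 2) ^ 3 :=
      pow_le_pow_right₀ (by linarith) hj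
    calc (1 + ∑ i, |w i| + ∑ i, w i ^ 2) ^ j * Real.exp (4 * t * ∑ i, |w i|) *
          Real.exp (-(t / 2 * ∑ i, w i ^ 2))
        ≤ (1 + ∑ i, |w i| + ∑ i, w i ^ 2) ^ 3 * Real.exp (4 * t * ∑ i, |w i|) *
          Real.exp (-(t / 2 * ∑ i, w i ^ 2)) := by gcongr
      _ ≤ C := hCb _ _ hS0 hM0 (Literature.Analysis.FluidPDE.CompressibleEuler.sq_sum_abs_le_three w)
  rw [kernSc_secondDiff_eq hφ w' u, kernSc_secondDiff_eq hφ w u]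
  refine (kernSc_Q_diff_bound _ _ _ _ _ _ _ _ (Real.exp_pos _).le).trans ?_
  refine kernSc_lip_combine (S := ∑ i, w i ^ 2) (M := ∑ i, |w i|) (Su := ∑ i, u i ^ 2)
    ht hρ0 hM0 hSu0 hK0 hK₁0 hGpow (by positivity) (abs_nonneg _) (abs_nonneg _) (abs_nonneg _) hS0
    (kernSc_lip_absize ht hρ0 hρ1 hS0 hM0 hSu0 hK0 (kernSc_sum_abs_le_of_close w w' hci)
      (sub_le_iff_le_add'.1 (abs_sub_le_iff.1 (kernSc_sum_sq_sub_le w w' hρ0 hci)).1)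
      (kernSc_abs_inner_le_sum_abs w' u hui) (kernSc_inner_sq_le w' u) (kernSc_inner_sq_le k u)
      (kernSc_ab_bound hτ0))
    (kernSc_lip_dabsize ht hρ0 hρ1 hS0 hM0 hSu0 hU0 hK₁0 (Literature.Analysis.FluidPDE.CompressibleEuler.sq_sum_abs_le_three u) hU3
      (kernSc_abs_inner_le_mul_sum_abs k u) (kernSc_abs_inner_le_mul_sum_abs w u)
      (kernSc_abs_inner_le_sum_abs w u hui) (kernSc_inner_sub_inner_le w w' u hci)
      (kernSc_ab_diff_bound _ _ _ _ hτ0))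
    (kernSc_abs_inner_sub_le k w w' hci) (kernSc_gauss_diff_le ht hρ0 hρ1 w w' hci)
    (Real.exp_le_exp.2 (by nlinarith [mul_nonneg ht.le hS0]))

/-- **Registered helper sub-goal `stub_kernelScaling_auxSecondDiff`** of stub `stub_kernelScaling`
(line `diffusive-branch-is-nonsaturation`, crux stmt-CriticalPhenomena-4799): Gaussian envelope and
equi-Lipschitz bound of the symmetric second differences of `φ(w) = e^{-t|w|₂²}cos(k·w)`, uniformly in
`|u|₂ ≤ 1`, and the Lipschitz bound for `φ`. [folklore] -/
theorem stub_kernelScaling_auxSecondDiff :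
    ∀ (t : ℝ) (k : Fin 3 → ℝ), 0 < t →
      (∃ A : ℝ, 0 < A ∧ ∀ (φ : (Fin 3 → ℝ) → ℝ),
        (∀ v, φ v = Real.exp (-(t * ∑ i, v i ^ 2)) * Real.cos (∑ i, k i * v i)) →
        ∀ w u : Fin 3 → ℝ, ∑ i, u i ^ 2 ≤ 1 →
          |2 * φ w - φ (w + u) - φ (w - u)| ≤ A * (∑ i, u i ^ 2) * Real.exp (-(t / 2 * ∑ i, w i ^ 2))) ∧
      (∃ L : ℝ, 0 < L ∧ ∀ (φ : (Fin 3 → ℝ) → ℝ),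
        (∀ v, φ v = Real.exp (-(t * ∑ i, v i ^ 2)) * Real.cos (∑ i, k i * v i)) →
        ∀ ρ : ℝ, 0 ≤ ρ → ρ ≤ 1 → ∀ w w' u : Fin 3 → ℝ, ∑ i, u i ^ 2 ≤ 1 → ‖w' - w‖ ≤ ρ →
          |(2 * φ w' - φ (w' + u) - φ (w' - u)) - (2 * φ w - φ (w + u) - φ (w - u))| ≤
            L * ρ * ∑ i, u i ^ 2) ∧
      (∃ L : ℝ, 0 < L ∧ ∀ (φ : (Fin 3 → ℝ) → ℝ),
        (∀ v, φ v = Real.exp (-(t * ∑ i, v i ^ 2)) * Real.cos (∑ i, k i * v i)) →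
        ∀ ρ : ℝ, 0 ≤ ρ → ρ ≤ 1 → ∀ w w' : Fin 3 → ℝ, ‖w' - w‖ ≤ ρ → |φ w' - φ w| ≤ L * ρ) :=
  fun _t k ht => ⟨kernSc_secondDiff_env ht k, kernSc_secondDiff_lipschitz ht k, kernSc_phi_lipschitz ht k⟩

end Summit.CriticalPhenomena.Ising3DConformalLimit.Cruxes.DirectCorrelationStableTail.DiffusiveBranchIsNonsaturation

end
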